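import Summits.AnomalousDissipation.AnomalousDissipation.Theorems.SawtoothPulseCascadeK1LocalisedCascadeAxisKernel

/-!
# K1loc, line `Spectral` / thin start — helper: THE TRAPEZOID PLATEAU SYMBOL AND THE `L¹` NORM OF ITS KERNEL (explicit)

Helper file of the prover lane on the crux `K1LocalisedCascade` (stmt-AnomalousDissipation-19491), route
`SawtoothPulseCascade` (S-D fibre ledger: a concrete lattice cut-off for `…HalfStepV/H`).  The trapezoid symbol with plateau
`L₁` and support `L₂` (`0 ≤ L₁ < L₂`, ramp width `D = L₂ − L₁`), `χ(m) = min(1, max(0, (L₂ − |m|)/D))`, satisfies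
`χ = 1` on `|m| ≤ L₁`, `χ = 0` on `|m| ≥ L₂`, `0 ≤ χ ≤ 1`, `|Δχ| ≤ 1/D`; hence (`…AxisKernel.integral_norm_trigPoly_le` with
`Λ = D`) **`∫_T |k_χ| ≤ √(π/D)·√((2L₂+1) + (2L₂+2)/16)`** (`integral_norm_trapezoidKernel_le`) — for a fixed ramp RATIO `L₂/D`
this is a constant independent of the scale.  The symbol is supplied through the hypothesis `hχ : ∀ m, χ m = …` (no
definitions).  No statement about the crux. [cite: Grafakos2014, §3.1.3] [problem: turb]
-/

-- `Summit.<Summit>.<Problem>`: single-conjunct summit, the duplicate namespace segment is deliberate.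
set_option linter.dupNamespace false

noncomputable section

namespace Summit.AnomalousDissipation.AnomalousDissipation.Theorems.SawtoothPulseCascade.K1Window

open MeasureTheory Set Filter Topology Function Complex
open scoped Real

/-! ## §1 The trapezoid symbol: plateau, support, size, differences -/

section Trapezoid

variable {χ : ℤ → ℂ} {L₁ L₂ : ℕ}

/-- `0 ≤ min(1, max(0, x)) ≤ 1` and the clamp is `1`-Lipschitz. [folklore] -/
theorem clamp_facts (x y : ℝ) :
    0 ≤ min 1 (max 0 x) ∧ min 1 (max 0 x) ≤ 1 ∧ |min 1 (max 0 x) - min 1 (max 0 y)| ≤ |x - y| := by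
  refine ⟨le_min zero_le_one (le_max_left _ _), min_le_left _ _, ?_⟩
  have h1 : |max 0 x - max 0 y| ≤ |x - y| := by
    rw [max_comm 0 x, max_comm 0 y]; exact abs_max_sub_max_le_abs _ _ _
  have h2 : |min 1 (max 0 x) - min 1 (max 0 y)| ≤ |max 0 x - max 0 y| := by
    refine (abs_min_sub_min_le_max 1 (max 0 x) 1 (max 0 y)).trans ?_
    rw [sub_self, abs_zero, max_eq_right (abs_nonneg _)]
  exact h2.trans h1

/-- Values of the trapezoid symbol: `1` on the plateau, `0` off the support, in `[0,1]` everywhere. [folklore] -/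
theorem trapezoid_values (hL : L₁ < L₂) (hχ : ∀ m : ℤ, χ m = ((min 1 (max 0 (((L₂ : ℝ) - |(m : ℝ)|) / ((L₂ : ℝ) - L₁))) : ℝ) : ℂ))
    (m : ℤ) :
    (|m| ≤ (L₁ : ℤ) → χ m = 1) ∧ ((L₂ : ℤ) ≤ |m| → χ m = 0) ∧ ‖χ m‖ ≤ 1 := by
  have hD : (0 : ℝ) < (L₂ : ℝ) - L₁ := by
    have : (L₁ : ℝ) < L₂ := by exact_mod_cast hL
    linarith
  refine ⟨fun hm => ?_, fun hm => ?_, ?_⟩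
  · rw [hχ]
    have hm' : |(m : ℝ)| ≤ L₁ := by
      have := (Int.cast_le (R := ℝ)).mpr hm; push_cast at this; exact this
    have h1 : 1 ≤ ((L₂ : ℝ) - |(m : ℝ)|) / ((L₂ : ℝ) - L₁) := by rw [le_div_iff₀ hD]; linarith
    rw [max_eq_right (zero_le_one.trans h1), min_eq_left h1]; simp
  · rw [hχ]
    have hm' : (L₂ : ℝ) ≤ |(m : ℝ)| := by
      have := (Int.cast_le (R := ℝ)).mpr hm; push_cast at this; exact this
    have h1 : ((L₂ : ℝ) - |(m : ℝ)|) / ((L₂ : ℝ) - L₁) ≤ 0 := div_nonpos_of_nonpos_of_nonneg (by linarith) hD.le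
    rw [max_eq_left h1, min_eq_right zero_le_one]; simp
  · rw [hχ, Complex.norm_real, Real.norm_eq_abs, abs_of_nonneg (clamp_facts _ 0).1]
    exact (clamp_facts _ 0).2.1

/-- The trapezoid symbol vanishes off `[-L₂, L₂]`. [folklore] -/
theorem trapezoid_support (hL : L₁ < L₂) (hχ : ∀ m : ℤ, χ m = ((min 1 (max 0 (((L₂ : ℝ) - |(m : ℝ)|) / ((L₂ : ℝ) - L₁))) : ℝ) : ℂ))
    (m : ℤ) (hm : m ∉ Finset.Icc (-(L₂ : ℤ)) L₂) : χ m = 0 := by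
  refine (trapezoid_values hL hχ m).2.1 ?_
  rw [Finset.mem_Icc, not_and_or, not_le, not_le] at hm
  rcases hm with h | h
  · rw [abs_of_neg (by omega)]; omega
  · rw [abs_of_pos (by omega)]; omega

/-- The forward difference of the trapezoid symbol is at most `1/D`, `D = L₂ − L₁`. [folklore] -/
theorem norm_trapezoid_diff_le (hL : L₁ < L₂)
    (hχ : ∀ m : ℤ, χ m = ((min 1 (max 0 (((L₂ : ℝ) - |(m : ℝ)|) / ((L₂ : ℝ) - L₁))) : ℝ) : ℂ)) (m : ℤ) :
    ‖χ (m + 1) - χ m‖ ≤ 1 / ((L₂ : ℝ) - L₁) := by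
  have hD : (0 : ℝ) < (L₂ : ℝ) - L₁ := by
    have : (L₁ : ℝ) < L₂ := by exact_mod_cast hL
    linarith
  rw [hχ, hχ, ← Complex.ofReal_sub, Complex.norm_real, Real.norm_eq_abs]
  refine (clamp_facts _ _).2.2.trans ?_
  rw [← sub_div, abs_div, abs_of_pos hD, div_le_div_iff_of_pos_right hD]
  push_cast
  have := abs_abs_sub_abs_le_abs_sub ((m : ℝ) + 1) (m : ℝ)
  rw [show ((L₂ : ℝ) - |(m : ℝ) + 1|) - ((L₂ : ℝ) - |(m : ℝ)|) = -(|(m : ℝ) + 1| - |(m : ℝ)|) by ring, abs_neg]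
  simpa using this

/-- `Σ' ‖χ(m)‖² ≤ 2L₂ + 1` for the trapezoid symbol. [folklore] -/
theorem tsum_norm_sq_trapezoid_le (hL : L₁ < L₂)
    (hχ : ∀ m : ℤ, χ m = ((min 1 (max 0 (((L₂ : ℝ) - |(m : ℝ)|) / ((L₂ : ℝ) - L₁))) : ℝ) : ℂ)) :
    ∑' m : ℤ, ‖χ m‖ ^ 2 ≤ 2 * L₂ + 1 := by
  classical
  rw [tsum_eq_sum (s := Finset.Icc (-(L₂ : ℤ)) L₂) fun m hm => by
    rw [trapezoid_support hL hχ m hm, norm_zero, zero_pow two_ne_zero]]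
  calc ∑ m ∈ Finset.Icc (-(L₂ : ℤ)) L₂, ‖χ m‖ ^ 2 ≤ ∑ m ∈ Finset.Icc (-(L₂ : ℤ)) L₂, (1 : ℝ) := by
        refine Finset.sum_le_sum fun m _ => ?_
        have h := (trapezoid_values hL hχ m).2.2
        nlinarith [norm_nonneg (χ m)]
    _ = 2 * L₂ + 1 := by
        rw [Finset.sum_const, nsmul_eq_mul, mul_one, Int.card_Icc]
        rw [show (L₂ : ℤ) + 1 - -(L₂ : ℤ) = (2 * L₂ + 1 : ℕ) by push_cast; ring, Int.toNat_natCast]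
        push_cast; ring

/-- `Σ' ‖Δχ(m)‖² ≤ (2L₂ + 2)/D²` for the trapezoid symbol. [folklore] -/
theorem tsum_norm_sq_trapezoid_diff_le (hL : L₁ < L₂)
    (hχ : ∀ m : ℤ, χ m = ((min 1 (max 0 (((L₂ : ℝ) - |(m : ℝ)|) / ((L₂ : ℝ) - L₁))) : ℝ) : ℂ)) :
    ∑' m : ℤ, ‖χ (m + 1) - χ m‖ ^ 2 ≤ (2 * L₂ + 2) * (1 / ((L₂ : ℝ) - L₁)) ^ 2 := by
  classical
  have hsupp : ∀ m : ℤ, m ∉ Finset.Icc (-(L₂ : ℤ) - 1) L₂ → χ (m + 1) - χ m = 0 := by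
    intro m hm
    rw [Finset.mem_Icc, not_and_or, not_le, not_le] at hm
    have h1 : χ m = 0 := trapezoid_support hL hχ m (by rw [Finset.mem_Icc, not_and_or, not_le, not_le]; omega)
    have h2 : χ (m + 1) = 0 := trapezoid_support hL hχ (m + 1) (by rw [Finset.mem_Icc, not_and_or, not_le, not_le]; omega)
    rw [h1, h2, sub_zero]
  rw [tsum_eq_sum (s := Finset.Icc (-(L₂ : ℤ) - 1) L₂) fun m hm => by rw [hsupp m hm, norm_zero, zero_pow two_ne_zero]]
  calc ∑ m ∈ Finset.Icc (-(L₂ : ℤ) - 1) L₂, ‖χ (m + 1) - χ m‖ ^ 2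
      ≤ ∑ m ∈ Finset.Icc (-(L₂ : ℤ) - 1) L₂, (1 / ((L₂ : ℝ) - L₁)) ^ 2 := by
        refine Finset.sum_le_sum fun m _ => ?_
        exact pow_le_pow_left₀ (norm_nonneg _) (norm_trapezoid_diff_le hL hχ m) 2
    _ = (2 * L₂ + 2) * (1 / ((L₂ : ℝ) - L₁)) ^ 2 := by
        rw [Finset.sum_const, nsmul_eq_mul, Int.card_Icc]
        rw [show (L₂ : ℤ) + 1 - (-(L₂ : ℤ) - 1) = (2 * L₂ + 2 : ℕ) by push_cast; ring, Int.toNat_natCast]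
        push_cast; ring

/-! ## §2 The `L¹` norm of the trapezoid kernel -/

/-- **`L¹` norm of the trapezoid kernel**: `∫_T |k_χ| ≤ √(π/D)·√((2L₂+1) + (2L₂+2)/16)`, `D = L₂ − L₁`
(`…AxisKernel.integral_norm_trigPoly_le` with `Λ = D`). [cite: Grafakos2014, §3.1.3] -/
theorem integral_norm_trapezoidKernel_le (hL : L₁ < L₂)
    (hχ : ∀ m : ℤ, χ m = ((min 1 (max 0 (((L₂ : ℝ) - |(m : ℝ)|) / ((L₂ : ℝ) - L₁))) : ℝ) : ℂ)) :
    ∫ s : UnitAddCircle, ‖∑' m : ℤ, χ m * fourier (-m) s‖ ≤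
      Real.sqrt (π / ((L₂ : ℝ) - L₁)) * Real.sqrt ((2 * L₂ + 1) + (2 * L₂ + 2) / 16) := by
  classical
  have hD : (0 : ℝ) < (L₂ : ℝ) - L₁ := by
    have : (L₁ : ℝ) < L₂ := by exact_mod_cast hL
    linarith
  have h := integral_norm_trigPoly_le (S := Finset.Icc (-(L₂ : ℤ)) L₂) (trapezoid_support hL hχ) hD
  refine h.trans (mul_le_mul_of_nonneg_left (Real.sqrt_le_sqrt ?_) (Real.sqrt_nonneg _))
  have h1 := tsum_norm_sq_trapezoid_le hL hχ
  have h2 := tsum_norm_sq_trapezoid_diff_le hL hχ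
  have h3 : ((L₂ : ℝ) - L₁) ^ 2 / 16 * ∑' m : ℤ, ‖χ (m + 1) - χ m‖ ^ 2 ≤ (2 * L₂ + 2) / 16 := by
    calc ((L₂ : ℝ) - L₁) ^ 2 / 16 * ∑' m : ℤ, ‖χ (m + 1) - χ m‖ ^ 2
        ≤ ((L₂ : ℝ) - L₁) ^ 2 / 16 * ((2 * L₂ + 2) * (1 / ((L₂ : ℝ) - L₁)) ^ 2) :=
          mul_le_mul_of_nonneg_left h2 (by positivity)
      _ = (2 * L₂ + 2) / 16 := by field_simp
  linarith

/-- The same for the kernel written as the finite sum over `[-L₂, L₂]`. [cite: Grafakos2014, §3.1.3] -/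
theorem integral_norm_trapezoidKernel_le' (hL : L₁ < L₂)
    (hχ : ∀ m : ℤ, χ m = ((min 1 (max 0 (((L₂ : ℝ) - |(m : ℝ)|) / ((L₂ : ℝ) - L₁))) : ℝ) : ℂ)) :
    ∫ s : UnitAddCircle, ‖∑ m ∈ Finset.Icc (-(L₂ : ℤ)) L₂, χ m * fourier (-m) s‖ ≤
      Real.sqrt (π / ((L₂ : ℝ) - L₁)) * Real.sqrt ((2 * L₂ + 1) + (2 * L₂ + 2) / 16) := by
  have h := integral_norm_trapezoidKernel_le hL hχ
  simp_rw [tsum_trigPoly_eq_sum (trapezoid_support hL hχ)] at h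
  exact h

end Trapezoid

end Summit.AnomalousDissipation.AnomalousDissipation.Theorems.SawtoothPulseCascade.K1Window
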